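import Mathlib
import Literature.Combinatorics.Additive.TripleProductProperty
import Summits.MatrixMultiplication.MatrixMultiplication.Statement
import Summits.MatrixMultiplication.MatrixMultiplication.Theorems.AutomaticSTPPDesignsSingleAutomatonRigidity

/-!
# fwd-rung 01 — next rung above `uniformCriticalPackingDecay` (SingleAutomatonRigidity floor)

FLOOR (tree, sorry-free): `Summit.MatrixMultiplication.MatrixMultiplication.Theorems.uniformCriticalPackingDecay`
— for every `c > 0` there is `N₀` such that every STPP family `(Aᵢ,Bᵢ,Cᵢ)` in every finite abelian
group `H` with `|H| ≥ N₀` has `∑ᵢ (|Aᵢ||Bᵢ||Cᵢ|)^{2/3} < c·|H|` (critical packing functional is `o(|H|)`,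
uniformly).  It is the content of the closed item stmt-MatrixMultiplication-7359.

The floor as the `r ≡ 1` member of the one-parameter family `CriticalDecayAtRate r`
("`∑ x^{2/3} = o(r(N)·N)` uniformly"); THE RUNG moves the rate parameter from `1` to `1/log log N`
(`CriticalDecayLogLog`).  Further rungs / side statements are banked below (all `Prop`s, no claims).
-/

open Finset
open Literature.Combinatorics.Additive

namespace Summit.MatrixMultiplication.MatrixMultiplication.Fwd.Rung01

/-- **Critical packing decay at rate `r` (little-o form).**  For every `c > 0`, once the finite abelian
group `H` is large enough, every STPP family `(Aᵢ, Bᵢ, Cᵢ)ᵢ` in `H` satisfies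
`∑ᵢ (|Aᵢ||Bᵢ||Cᵢ|)^{2/3} < c · r(|H|) · |H|`.  `r ≡ 1` is the floor (`floor_rate_one`). -/
def CriticalDecayAtRate (r : ℕ → ℝ) : Prop :=
  ∀ c : ℝ, 0 < c → ∃ N₀ : ℕ, ∀ (H : Type) [AddCommGroup H] [Fintype H], N₀ ≤ Fintype.card H →
    ∀ (ι : Type) [Fintype ι] (A B C : ι → Finset H), AddSimultaneousTPP A B C →
      ∑ i, (((A i).card * (B i).card * (C i).card : ℕ) : ℝ) ^ ((2 : ℝ) / 3) <
        c * r (Fintype.card H) * (Fintype.card H : ℝ)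

/-- FLOOR = the rung family at parameter `r ≡ 1`, discharged by the tree theorem. -/
theorem floor_rate_one : CriticalDecayAtRate (fun _ => 1) := by
  intro c hc
  obtain ⟨N₀, h⟩ := Theorems.uniformCriticalPackingDecay c hc
  refine ⟨N₀, fun H _ _ hN ι _ A B C hS => ?_⟩
  simpa using h H hN ι A B C hS

/-- **THE RUNG (rate `1/log log N`).**  The critical packing functional of STPP families in finite
abelian groups of order `N` is `o(N / log log N)`, uniformly.  Open even for one-element blocks in
`ℤ/N` (= tricolored sum-free sets / the arithmetic Ruzsa–Szemerédi problem), where the removal-lemma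
proof of the floor gives only an inverse-tower rate. -/
def CriticalDecayLogLog : Prop :=
  CriticalDecayAtRate (fun N => (Real.log (Real.log (N : ℝ)))⁻¹)

/-- Gap-after rung: rate `1/log N`. -/
def CriticalDecayLog : Prop :=
  CriticalDecayAtRate (fun N => (Real.log (N : ℝ))⁻¹)

/-- Gap-after rung (quasi-Behrend): rate `exp(-(log N)^κ)` for some `κ > 0`; `κ = 1/2` is the
Behrend wall for one-element blocks in `ℤ/N`. -/
def CriticalDecayQuasiBehrend : Prop :=
  ∃ κ : ℝ, 0 < κ ∧ CriticalDecayAtRate (fun N => Real.exp (-(Real.log (N : ℝ)) ^ κ))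

/-- A rate rung implies the floor's family member whenever the rate is eventually `≤ 1`
(bookkeeping; used to certify RUNG ⇒ FLOOR). -/
theorem CriticalDecayAtRate.of_eventually_le {r s : ℕ → ℝ} (h : CriticalDecayAtRate r)
    (hrs : ∃ N₁ : ℕ, ∀ N, N₁ ≤ N → r N ≤ s N) : CriticalDecayAtRate s := by
  intro c hc
  obtain ⟨N₀, h⟩ := h c hc
  obtain ⟨N₁, hrs⟩ := hrs
  refine ⟨max N₀ N₁, fun H _ _ hN ι _ A B C hS => ?_⟩
  have h1 := h H ((le_max_left _ _).trans hN) ι A B C hS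
  have h2 : c * r (Fintype.card H) * (Fintype.card H : ℝ) ≤
      c * s (Fintype.card H) * (Fintype.card H : ℝ) := by
    have := hrs _ ((le_max_right _ _).trans hN)
    have hc' : 0 ≤ c := hc.le
    have hN' : (0 : ℝ) ≤ (Fintype.card H : ℝ) := by positivity
    nlinarith [mul_le_mul_of_nonneg_left this hc']
  exact h1.trans_le h2

/-- **Side statement A (same-method extension, banked, NOT the rung): non-commutative groups.**
The floor with commutativity dropped (`AddGroup`, Mathlib's additive spelling of an arbitrary
group; the multiplicative reading is `SimultaneousTPP` in any finite group via `Multiplicative`).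
Expected provable by the floor's method with Green's abelian removal lemma replaced by the
Král'–Serra–Vena removal lemma for `x₁x₂x₃ = 1` in arbitrary finite groups. -/
def NoncommCriticalDecay : Prop :=
  ∀ c : ℝ, 0 < c → ∃ N₀ : ℕ, ∀ (G : Type) [AddGroup G] [Fintype G], N₀ ≤ Fintype.card G →
    ∀ (ι : Type) [Fintype ι] (A B C : ι → Finset G), AddSimultaneousTPP A B C →
      ∑ i, (((A i).card * (B i).card * (C i).card : ℕ) : ℝ) ^ ((2 : ℝ) / 3) <
        c * (Fintype.card G : ℝ)

/-- The commutative specialisation of `NoncommCriticalDecay` IS the floor, verbatim. -/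
theorem noncomm_comm_case :
    ∀ c : ℝ, 0 < c → ∃ N₀ : ℕ, ∀ (G : Type) [AddCommGroup G] [Fintype G], N₀ ≤ Fintype.card G →
      ∀ (ι : Type) [Fintype ι] (A B C : ι → Finset G), AddSimultaneousTPP A B C →
        ∑ i, (((A i).card * (B i).card * (C i).card : ℕ) : ℝ) ^ ((2 : ℝ) / 3) <
          c * (Fintype.card G : ℝ) :=
  fun c hc => Theorems.uniformCriticalPackingDecay c hc

/-- **Side statement B (the `ι = Unit` shadow of A, multiplicative): TPP capacity decay.**
Neumann's TPP capacity `β(G) = max |S||T||U|` over TPP triples satisfies `β(G) = o(|G|^{3/2})`;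
the best bound in print is `β(G) ≤ (|G|/2)^{3/2} + O(|G|)` (Neumann 2011, Cor. 3.2).  Equivalently the
Cohn–Umans pseudo-exponent obeys `(α(G) - 2)·log|G| → ∞`. -/
def TPPCapacityDecay : Prop :=
  ∀ c : ℝ, 0 < c → ∃ N₀ : ℕ, ∀ (G : Type) [Group G] [Fintype G], N₀ ≤ Fintype.card G →
    ∀ S T U : Finset G, TripleProductProperty S T U →
      ((S.card * T.card * U.card : ℕ) : ℝ) < c * (Fintype.card G : ℝ) ^ ((3 : ℝ) / 2)

end Summit.MatrixMultiplication.MatrixMultiplication.Fwd.Rung01
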